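import Mathlib
import HarnessLib
import Summits.HubbardSuperconductivity.HubbardSuperconductivity.Theorems.KLProgrammeC4aRadialRowOne
import Summits.HubbardSuperconductivity.HubbardSuperconductivity.Theorems.KLProgrammeC4aBellRigidBounds
import Summits.HubbardSuperconductivity.HubbardSuperconductivity.Theorems.KLProgrammeC4aCoMovingBridge

/-!
# Route `KLProgramme` — crux C4a, (L3) ASSEMBLED for the particle–particle class: `CoMovingJetsL1 4` with CONSTANT, scale-free dominators for
# `V(k,q) = B(k+q)` from an INVERSE-POWER majorant of the bubble `B` — modulo only the order-2/3 radial rows of the chart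

Cell `gate-hubbard-kl`, lane hubbard-kl-c4a-1 (g5); helper for stub (C) `stub_twoLeg_curvature` of the engine-flow child `KLRegimeEngineV17F2`
(stmt-HubbardSuperconductivity-20437); memo HOME/hubbard-kl-c4a-1/C4A-PLAN.md §22.6.  This file composes the (L3) geometry package —
`…C4aCoMovingBridge` (complex Bell bound), `…C4aPathRigidity` (`‖∂ⁱS(0)‖ ≤ Lr + msD(i+1)|ϑ−π|`), `…C4aRadialRowOne` (order-1 radial row discharged),
`…C4aPathComparability` (`‖S(0)‖ ≥ c(|ρ|+|ϑ−π|)`), `…C4aBellRigidBounds` (`bell4 ≤ Cb·P_j(x)`) — into ONE statement the (A) capstone consumes: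

**`coMovingJetsL1_pairSum_of_inversePower`.**  Let `B : Momentum → ℂ` be `C⁴` with `‖B‖ ≤ Cb0` and, for `1 ≤ k ≤ 4` and every `p`,
`‖DᵏB(p)‖ ≤ Cb·(max(c′‖p‖, Λ)^k)⁻¹` (`Cb ≥ 0`, `c′, Λ > 0` — the scale-resolved pp bubble above scale `Λ = Λ_n`, S3's deliverable); let the chart's radial
rows of orders 2, 3 be `‖γ_ρ⁽ⁱ⁾(s) − γ₀⁽ⁱ⁾(s)‖ ≤ Lradᵢ|ρ|` (k3c3-p3's deliverable).  Then `CoMovingJetsL1 4 (fun i _ => ppJetDominator Cb Cb0 x Λ (2·msD A₃ A₄ 4) i) r μ K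
(fun k q => B(k+q))` with CONSTANT dominators `2Cb0, 2Cb·x, 2Cb(x²+x), 2Cb(x³+3x²+x), 2(Cb(x⁴+6x³+7x²) + (Cb/Λ)·2msD₄)`, `x = L/(c′·pairSumLowerConst r)`,
`L = max` of the row/angular coefficients.  Orders `1…3` are FREE OF `Λ` (the inner co-moving gain); order 4 carries `Cb/Λ` from the one non-rigid
monomial (far inside the order-4 budget).  Arbitrary loop angles are reduced to `[0, 2π)` by periodicity of the chart.

* §1 `levelPoint_add_zsmul_two_pi`, `coMoving_angle_periodic` (periodic reduction), `volume_box_lt_top`, `integrableOn_const_box`;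
* §2 `ppJetDominator` (def), **`coMovingJetsL1_pairSum_of_inversePower`**.

Proved composition keyed by the frame's sizes as `…C4aPathJets`; nothing about the Hubbard model's sizes; nothing asserts superconductivity.
References: FST II CPAM 51 (1998) §3 Thm 3.5; BGM 2006 §2.4 (2.36)–(2.41) [cite: BenfattoGiulianiMastropietro2006].
-/

noncomputable section

namespace Summit.HubbardSuperconductivity.HubbardSuperconductivity.Theorems.C4a

set_option linter.dupNamespace false -- summit = problem name (single-conjunct summit), D-0017

open Real Set MeasureTheory Finset
open scoped ContDiff
open Literature.MathematicalPhysics.QuantumLattice Literature.MathematicalPhysics.QuantumLattice.BandSectorCounting Literature.Probability.LatticeModels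
open Summit.HubbardSuperconductivity.HubbardSuperconductivity.Theorems.KLRegimeSplit
open Summit.HubbardSuperconductivity.HubbardSuperconductivity.Theorems.DispersionFlow
open Summit.HubbardSuperconductivity.HubbardSuperconductivity.Theorems.PerturbedFermiCurve

/-! ## §1 Periodic reduction of the loop angle; constants are integrable on the chart box -/

/-- The level curves are periodic under integer multiples of `2π`. -/
theorem levelPoint_add_zsmul_two_pi (μ : ℝ) (K : TrigPolyC4v) (ρ s : ℝ) (k : ℤ) :
    levelPoint μ K ρ (s + k • (2 * π)) = levelPoint μ K ρ s := by
  simp only [levelPoint, (klFermiPoint_periodic (μ + ρ) K).zsmul k s]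

/-- **Periodic reduction of the loop angle**: the co-moving reading at base angles `(θ, ϑ + θ)` only depends on `ϑ` modulo `2π`. -/
theorem coMoving_angle_periodic (μ : ℝ) (K : TrigPolyC4v) (V : Momentum → Momentum → ℂ) (θ ρ ϑ : ℝ) (k : ℤ) :
    coMoving μ K V θ ρ (ϑ + k • (2 * π) + θ) = coMoving μ K V θ ρ (ϑ + θ) := by
  funext t
  simp only [coMoving]
  rw [show ϑ + k • (2 * π) + θ + t = (ϑ + θ + t) + k • (2 * π) by ring, levelPoint_add_zsmul_two_pi]

/-- The chart box has finite measure. -/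
theorem volume_box_lt_top (r : ℝ) : volume (Ioo (-r) r ×ˢ Ioc 0 (2 * π)) < ⊤ := by
  rw [Measure.volume_eq_prod, Measure.prod_prod]
  exact ENNReal.mul_lt_top (by rw [Real.volume_Ioo]; exact ENNReal.ofReal_lt_top) (by rw [Real.volume_Ioc]; exact ENNReal.ofReal_lt_top)

/-- Constants are integrable on the chart box. -/
theorem integrableOn_const_box (r C : ℝ) : IntegrableOn (fun _ : ℝ × ℝ => C) (Ioo (-r) r ×ˢ Ioc 0 (2 * π)) :=
  integrableOn_const (volume_box_lt_top r).ne

/-! ## §2 The assembled pp-class dominators -/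

/-- **The constant pp-class jet dominators** (`Cb` the bubble's inverse-power size, `Cb0` its sup, `x = L/c₁` the rigidity/comparability ratio, `Λ` the
scale floor, `D4` the order-4 path-jet table): `0 ↦ 2Cb0`, `1 ↦ 2Cb·x`, `2 ↦ 2Cb(x²+x)`, `3 ↦ 2Cb(x³+3x²+x)`, `4 ↦ 2(Cb(x⁴+6x³+7x²) + Cb/Λ·D4)`, else `0`. -/
def ppJetDominator (Cb Cb0 x Λ D4 : ℝ) : ℕ → ℝ
  | 0 => 2 * Cb0
  | 1 => 2 * (Cb * x)
  | 2 => 2 * (Cb * (x ^ 2 + x))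
  | 3 => 2 * (Cb * (x ^ 3 + 3 * x ^ 2 + x))
  | 4 => 2 * (Cb * (x ^ 4 + 6 * x ^ 3 + 7 * x ^ 2) + Cb / Λ * D4)
  | _ => 0

section Sizes

variable {K : TrigPolyC4v} {A : ℝ} (hA : ∀ p : Momentum, ∀ j ≤ 2, ‖iteratedFDeriv ℝ j (frameShift K) p‖ ≤ A) (hA20 : A ≤ 1 / 20)
  (hd : klCurveD ≤ (bandBounds (show (-4 : ℝ) < -1.1 by norm_num) (show (-1.1 : ℝ) ≤ -0.1 by norm_num)
    (show (-0.1 : ℝ) < 0 by norm_num)).Dtmin - 2 * A)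
  {μ r : ℝ} (hr : 0 < r) (hlo : (-1.1 : ℝ) < μ - r - A) (hhi : μ + r + A < -0.1)
  {A₃ A₄ : ℝ} (hA₃ : ∀ p : Momentum, ‖iteratedFDeriv ℝ 3 (frameShift K) p‖ ≤ A₃)
  (hA₄ : ∀ p : Momentum, ‖iteratedFDeriv ℝ 4 (frameShift K) p‖ ≤ A₄)
include hA hA20 hd hr hlo hhi hA₃ hA₄

/-- **(L3) FOR THE PARTICLE–PARTICLE CLASS, ASSEMBLED.**  For `B : Momentum → ℂ` of class `C⁴` with `‖B(p)‖ ≤ Cb0` and the INVERSE-POWER majorant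
`‖DᵏB(p)‖ ≤ Cb·(max(c′‖p‖, Λ)^k)⁻¹` (`1 ≤ k ≤ 4`; `0 ≤ Cb`, `0 < c′`, `0 < Λ`), and the chart's radial rows of orders 2 and 3 (`0 ≤ Lrad₂`):
`CoMovingJetsL1 4 (fun i _ => ppJetDominator Cb Cb0 x Λ (2·msD A₃ A₄ 4) i) r μ K (fun k q => B (k + q))` with
`x = max(max(radialRowOneConst A (Dt_min−2A), msD A₃ A₄ 2), max(max(Lrad₂, msD A₃ A₄ 3), max(Lrad₃, msD A₃ A₄ 4))) / (c′·pairSumLowerConst r)`.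
[cite: BenfattoGiulianiMastropietro2006, §2.4 (2.36)–(2.41)] -/
theorem coMovingJetsL1_pairSum_of_inversePower {Bf : Momentum → ℂ} (hB : ContDiff ℝ 4 Bf) {Cb Cb0 c' Λ Lrad₂ Lrad₃ : ℝ} (hCb : 0 ≤ Cb)
    (hc' : 0 < c') (hΛ : 0 < Λ) (hL₂ : 0 ≤ Lrad₂)
    (hBk : ∀ p : Momentum, ∀ k, 1 ≤ k → k ≤ 4 → ‖iteratedFDeriv ℝ k Bf p‖ ≤ Cb * ((max (c' * ‖p‖) Λ) ^ k)⁻¹)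
    (hB0 : ∀ p : Momentum, ‖Bf p‖ ≤ Cb0)
    (hrow₂ : ∀ ρ : ℝ, |ρ| < r → ∀ s : ℝ, ‖iteratedDeriv 2 (levelPoint μ K ρ) s - iteratedDeriv 2 (levelPoint μ K 0) s‖ ≤ Lrad₂ * |ρ|)
    (hrow₃ : ∀ ρ : ℝ, |ρ| < r → ∀ s : ℝ, ‖iteratedDeriv 3 (levelPoint μ K ρ) s - iteratedDeriv 3 (levelPoint μ K 0) s‖ ≤ Lrad₃ * |ρ|) :
    CoMovingJetsL1 4
      (fun i _ => ppJetDominator Cb Cb0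
        (max (max (radialRowOneConst A ((bandBounds (show (-4 : ℝ) < -1.1 by norm_num) (show (-1.1 : ℝ) ≤ -0.1 by norm_num)
            (show (-0.1 : ℝ) < 0 by norm_num)).Dtmin - 2 * A)) (msD A₃ A₄ 2)) (max (max Lrad₂ (msD A₃ A₄ 3)) (max Lrad₃ (msD A₃ A₄ 4))) /
          (c' * pairSumLowerConst r)) Λ (2 * msD A₃ A₄ 4) i)
      r μ K (fun k q => Bf (k + q)) := by
  set B₀ := bandBounds (show (-4 : ℝ) < -1.1 by norm_num) (show (-1.1 : ℝ) ≤ -0.1 by norm_num) (show (-0.1 : ℝ) < 0 by norm_num) with hB₀def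
  set dmin := B₀.Dtmin - 2 * A with hdmin
  set c := pairSumLowerConst r with hcdef
  set c₁ := c' * c with hc₁def
  set L := max (max (radialRowOneConst A dmin) (msD A₃ A₄ 2)) (max (max Lrad₂ (msD A₃ A₄ 3)) (max Lrad₃ (msD A₃ A₄ 4))) with hLdef
  set x := L / c₁ with hxdef
  have hADt : 2 * A < B₀.Dtmin := by have := klCurveD_pos; linarith
  have hc0 : 0 < c := pairSumLowerConst_pos hr
  have hc₁0 : 0 < c₁ := mul_pos hc' hc0
  -- nonnegativity of the tables (they dominate norms)
  have h0r : |(0 : ℝ)| < r := by simpa using hr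
  have hD2nn : 0 ≤ msD A₃ A₄ 2 := (norm_nonneg _).trans (norm_iteratedDeriv_levelPoint_le hA hA20 hd hlo hhi hA₃ hA₄ h0r (i := 2) (by norm_num) (by norm_num) 0)
  have hD3nn : 0 ≤ msD A₃ A₄ 3 := (norm_nonneg _).trans (norm_iteratedDeriv_levelPoint_le hA hA20 hd hlo hhi hA₃ hA₄ h0r (i := 3) (by norm_num) (by norm_num) 0)
  have hD4nn : 0 ≤ msD A₃ A₄ 4 := (norm_nonneg _).trans (norm_iteratedDeriv_levelPoint_le hA hA20 hd hlo hhi hA₃ hA₄ h0r (i := 4) (by norm_num) (by norm_num) 0)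
  have hL0 : 0 ≤ L := le_trans hL₂ ((le_max_left _ _).trans ((le_max_left _ _).trans (le_max_right _ _)))
  have hx0 : 0 ≤ x := div_nonneg hL0 hc₁0.le
  -- coefficient dominations by L
  have hL1a : radialRowOneConst A dmin ≤ L := (le_max_left _ _).trans (le_max_left _ _)
  have hL1b : msD A₃ A₄ 2 ≤ L := (le_max_right _ _).trans (le_max_left _ _)
  have hL2a : Lrad₂ ≤ L := (le_max_left _ _).trans ((le_max_left _ _).trans (le_max_right _ _))
  have hL2b : msD A₃ A₄ 3 ≤ L := (le_max_right _ _).trans ((le_max_left _ _).trans (le_max_right _ _))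
  have hL3a : Lrad₃ ≤ L := (le_max_left _ _).trans ((le_max_right _ _).trans (le_max_right _ _))
  have hL3b : msD A₃ A₄ 4 ≤ L := (le_max_right _ _).trans ((le_max_right _ _).trans (le_max_right _ _))
  refine ⟨fun i _ => integrableOn_const_box r _, fun θ ρ ϑ hρ => ?_⟩
  -- periodic reduction of the loop angle to [0, 2π)
  set ϑ₀ := toIcoMod Real.two_pi_pos 0 ϑ with hϑ₀def
  have hϑ₀mem : ϑ₀ ∈ Ico 0 (0 + 2 * π) := toIcoMod_mem_Ico Real.two_pi_pos 0 ϑ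
  have hϑ₀Icc : ϑ₀ ∈ Icc 0 (2 * π) := ⟨hϑ₀mem.1, by linarith [hϑ₀mem.2]⟩
  have hϑeq : ϑ₀ + toIcoDiv Real.two_pi_pos 0 ϑ • (2 * π) = ϑ := toIcoMod_add_toIcoDiv_zsmul Real.two_pi_pos 0 ϑ
  have hco : coMoving μ K (fun k q => Bf (k + q)) θ ρ (ϑ + θ) = coMoving μ K (fun k q => Bf (k + q)) θ ρ (ϑ₀ + θ) := by
    rw [← hϑeq]; exact coMoving_angle_periodic μ K _ θ ρ ϑ₀ _
  rw [hco, coMoving_pairSum]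
  have hS : ContDiff ℝ 4 (pairSumPath μ K ρ ϑ₀ θ) := contDiff_infty.1 (contDiff_pairSumPath B₀ hA hADt hr hlo hhi hρ ϑ₀ θ (m := ⊤)) 4
  refine ⟨hB.comp hS, fun i hi => ?_⟩
  -- the chart distance, the scale floor, and the pointwise majorants
  set δ := |ρ| + |ϑ₀ - π| with hδdef
  have hδ0 : 0 ≤ δ := by positivity
  set m := max (c₁ * δ) Λ with hmdef
  have hm0 : 0 < m := lt_max_of_lt_right hΛ
  have hmΛ : Λ ≤ m := le_max_right _ _
  have hcomp : c * δ ≤ ‖pairSumPath μ K ρ ϑ₀ θ 0‖ := norm_pairSumPath_zero_ge hA hA20 hd hr hlo hhi hA₃ hA₄ hρ hϑ₀Icc θ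
  have hm_le : m ≤ max (c' * ‖pairSumPath μ K ρ ϑ₀ θ 0‖) Λ :=
    max_le_max (by rw [hc₁def, mul_assoc]; exact mul_le_mul_of_nonneg_left hcomp hc'.le) le_rfl
  set M : ℕ → ℝ := fun k => if k = 0 then Cb0 else Cb / m ^ k with hMdef
  set D : ℕ → ℝ := fun i => ‖iteratedDeriv i (pairSumPath μ K ρ ϑ₀ θ) 0‖ with hDdef
  have hMk : ∀ k, 1 ≤ k → k ≤ 4 → ‖iteratedFDeriv ℝ k Bf (pairSumPath μ K ρ ϑ₀ θ 0)‖ ≤ M k := by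
    intro k hk1 hk4
    have hk0 : k ≠ 0 := by omega
    simp only [hMdef, hk0, if_false]
    refine (hBk _ k hk1 hk4).trans ?_
    rw [div_eq_mul_inv]
    refine mul_le_mul_of_nonneg_left ?_ hCb
    exact inv_anti₀ (pow_pos hm0 k) (pow_le_pow_left₀ hm0.le hm_le k)
  have hM0 : ‖Bf (pairSumPath μ K ρ ϑ₀ θ 0)‖ ≤ M 0 := by simp only [hMdef, if_true]; exact hB0 _
  have hDi : ∀ i, 1 ≤ i → i ≤ 4 → ‖iteratedDeriv i (pairSumPath μ K ρ ϑ₀ θ) 0‖ ≤ D i := fun i _ _ => le_rfl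
  have hbell := norm_iteratedDeriv_comp_le_bell4_complex hB hS hMk hM0 hDi hi
  -- rigidity: D i ≤ L δ ≤ x m for i ≤ 3
  have hLδ : L * δ ≤ x * m := by
    have h := mul_max_le (δ := δ) (Λ := Λ) hc₁0 hL0
    rwa [← hxdef, ← hmdef] at h
  have hDs : ∀ i, 1 ≤ i → i ≤ 3 → D i ≤ x * m := by
    intro i hi1 hi3
    refine le_trans ?_ hLδ
    interval_cases i
    · refine (norm_deriv_pairSumPath_le_rigid hA hA20 hd hr hlo hhi hA₃ hA₄ hρ ϑ₀ θ).trans ?_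
      rw [hδdef, mul_add]
      exact add_le_add (mul_le_mul_of_nonneg_right hL1a (abs_nonneg _)) (mul_le_mul_of_nonneg_right hL1b (abs_nonneg _))
    · refine (norm_iteratedDeriv_pairSumPath_le_rigid hA hA20 hd hr hlo hhi hA₃ hA₄ hρ (i := 2) (by norm_num) (hrow₂ ρ hρ) ϑ₀ θ).trans ?_
      rw [hδdef, mul_add]
      exact add_le_add (mul_le_mul_of_nonneg_right hL2a (abs_nonneg _)) (mul_le_mul_of_nonneg_right hL2b (abs_nonneg _))
    · refine (norm_iteratedDeriv_pairSumPath_le_rigid hA hA20 hd hr hlo hhi hA₃ hA₄ hρ (i := 3) (by norm_num) (hrow₃ ρ hρ) ϑ₀ θ).trans ?_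
      rw [hδdef, mul_add]
      exact add_le_add (mul_le_mul_of_nonneg_right hL3a (abs_nonneg _)) (mul_le_mul_of_nonneg_right hL3b (abs_nonneg _))
  have hDs0 : ∀ i, 1 ≤ i → i ≤ 4 → 0 ≤ D i := fun i _ _ => norm_nonneg _
  have hMb0 : ∀ k, 1 ≤ k → k ≤ 4 → 0 ≤ M k := fun k hk1 hk4 => (norm_nonneg _).trans (hMk k hk1 hk4)
  have hMb : ∀ k, 1 ≤ k → k ≤ 4 → M k ≤ Cb / m ^ k := by
    intro k hk1 _; have hk0 : k ≠ 0 := by omega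
    simp only [hMdef, hk0, if_false, le_refl]
  obtain ⟨r1, r2, r3, r4⟩ := bell4_le_of_rigid hm0 hMb0 hMb hDs0 hDs
  -- the order-4 non-rigid monomial: M 1 · D 4 ≤ (Cb/Λ)·(2 msD₄)
  have hD4 : D 4 ≤ 2 * msD A₃ A₄ 4 := norm_iteratedDeriv_pairSumPath_le hA hA20 hd hr hlo hhi hA₃ hA₄ θ ρ ϑ₀ hρ 4 (by norm_num) le_rfl
  have hM1 : M 1 ≤ Cb / Λ := by
    have h1 : (1 : ℕ) ≠ 0 := one_ne_zero
    simp only [hMdef, h1, if_false, pow_one]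
    exact div_le_div_of_nonneg_left hCb hΛ hmΛ
  have hM1D4 : M 1 * D 4 ≤ Cb / Λ * (2 * msD A₃ A₄ 4) :=
    mul_le_mul hM1 hD4 (norm_nonneg _) (div_nonneg hCb hΛ.le)
  refine hbell.trans ?_
  interval_cases i
  · simp only [bell4, ppJetDominator, hMdef, if_true]; exact le_rfl
  · simp only [ppJetDominator]; linarith
  · simp only [ppJetDominator]; linarith
  · simp only [ppJetDominator]; linarith
  · simp only [ppJetDominator]; linarith

end Sizes

end Summit.HubbardSuperconductivity.HubbardSuperconductivity.Theorems.C4a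

end
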